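import Literature.Computability.FineGrained.IPRenameTruthTable
import Literature.Computability.FineGrained.IPRenameTables
import HarnessLib

/-!
# The renaming machine of Impagliazzo–Paturi's Lemma 2, III: the register file; looking a
variable up in the tuple register

Family `fine-grained` (trunk T-CPLX-FINE). Third file of the machine half of
Impagliazzo–Paturi, *On the complexity of k-SAT*, JCSS 62 (2001), Lemma 2 (the named fact
`ipRename_reduceList_computable` of `IPLemma2Assembly.lean`), after `IPRenameTruthTable.lean`
(the emission loop `cnfLoop` on the bank `TB`, around an abstract evaluator) and
`IPRenameTables.lean` (the tables the evaluator reads). This file fixes the register file of the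
whole machine and provides the evaluator's innermost routine.

* `KR` — the work registers (input/output, parsed formula, dictionaries and tables of the
  phases, scratch, spares); `Reg := TB ⊕ KR`, `RProg`, `RStore`, `tb`, `kr`. Routines from now
  on are programs over `Reg`; their specifications quantify over an arbitrary store `S` and
  describe only the registers they touch (a small *store family* `lvSt S …` with `simp` lemmas
  for reading and updating), so that they compose by rewriting alone.
* `lookupB L ν` — the value of the new variable `ν` under the tuple held as the literal list
  `L` in the tuple register `vt` (polarity of the first literal on `ν`, `false` if none);
  `asg_eq_lookupB`: for `L = V.zip bs` this is `IPRename.asg V bs ν`, the assignment at which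
  `IPRename.cnf` evaluates.
* `lookupVal` / **`runs_lookupVal`** — with the reversed index token `rbits ν` in the probe
  register `pr`: copy `vt`, scan it entry by entry (polarity bit to `eb`, index bits to `ex`,
  at the comma compare `ex` with `pr` by the generic `eqW` of `IPRenameRoutines.lean` unless a
  match was found before, on a match keep the polarity), normalise: `val := flagW (lookupB L ν)`,
  everything else restored; cost `(12 |rbits ν| + 46) · |cbody L| + 10`.

## References

* R. Impagliazzo, R. Paturi, *On the complexity of k-SAT*, J. Comput. System Sci. 62 (2001)
  367–375, doi:10.1006/jcss.2000.1727, Lemma 2 (p. 373) and its "Moreover" sentence.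
  (Not held; acquisition request acq-00143.)
* T. Nipkow, G. Klein, *Concrete Semantics with Isabelle/HOL*, Springer 2014, Ch. 7.
-/

namespace Literature.Computability.FineGrained.IPRenameM

open _root_.Computability Complexity Complexity.ACom Sparsifier IPRename

/-! ### The register file of the renaming machine -/

/-- The work registers of the renaming machine (everything except the emission bank `TB`):
input/output, the parsed formula, the dictionaries and tables of the phases, and scratch
registers (several spares). [folklore] -/
inductive KR where
  | inp | out | hdr | fam | fam2 | nun | thr | u1 | u2 | u3
  | oc | oc2 | key | cols | cnt | c | c2 | fl | fl2 | fl3 | x2 | ne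
  | dict | dict2 | na | ac | ac2 | bt | szs | szs2 | fv | fv2 | yt | hd2 | ycnt | t1 | t2
  | cl | clw | md | pol | tag | pr | pr2 | iu | iu2 | ju | res | vw | ex | eb | fnd | val | lmd
  | btw | md2 | pt | pf | allf | ft | ff | gt | gf | pos | done | ru | cntf | lpol | ytw | yv
  | sat | blk | posc
  | s0 | s1 | s2 | s3 | s4 | s5 | s6 | s7
  deriving DecidableEq, Fintype

/-- The whole register file: the emission bank and the work registers. [folklore] -/
abbrev Reg : Type := TB ⊕ KR

/-- Programs of the renaming machine. [folklore] -/
abbrev RProg : Type := ACom Γ' Reg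

/-- Stores of the renaming machine. [folklore] -/
abbrev RStore : Type := AStore Γ' Reg

/-- A register of the emission bank. [folklore] -/
abbrev tb (r : TB) : Reg := Sum.inl r

/-- A work register. [folklore] -/
abbrev kr (r : KR) : Reg := Sum.inr r

/-! ### Looking up the value of a new variable in the tuple register -/

/-- The value of the variable `ν` in the literal list `L` (polarity of its first literal on `ν`,
`false` if none) — for `L = V.zip bs` this is `IPRename.asg V bs ν`. [folklore] -/
def lookupB (L : List Lit) (ν : ℕ) : Bool := ((L.find? fun l => l.1 == ν).map Prod.snd).getD false

/-- `asg` is a lookup in the zipped list. [folklore] -/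
theorem asg_eq_lookupB : ∀ (V : List ℕ) (bs : List Bool), bs.length = V.length → ∀ ν : ℕ,
    asg V bs ν = lookupB (V.zip bs) ν
  | [], [], _, ν => by simp [asg, lookupB]
  | v :: V, b :: bs, h, ν => by
    have h' : bs.length = V.length := by simpa using h
    have ih := asg_eq_lookupB V bs h' ν
    unfold asg lookupB at *
    by_cases hv : v = ν
    · subst hv; simp
    · have hne : (v == ν) = false := by simpa using hv
      rw [List.zip_cons_cons, List.find?_cons]
      simp only [hne]
      rw [← ih, List.idxOf_cons_ne _ hv]
      simp
  | [], _ :: _, h, _ => by simp at h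
  | _ :: _, [], h, _ => by simp at h

/-- The registers of the generic equality routine inside the register file: probe `pr`, stream
`ex`, scratch `x2`, flag `ne`. [folklore] -/
def embEq : EqR → Reg
  | EqR.x => kr KR.pr
  | EqR.y => kr KR.ex
  | EqR.x2 => kr KR.x2
  | EqR.ne => kr KR.ne

/-- `embEq` is injective. [folklore] -/
theorem embEq_injective : Function.Injective embEq := by
  intro a b h; cases a <;> cases b <;> first | rfl | cases h

/-- At the comma closing an entry of the tuple register: unless a match was found already,
compare the entry's index (in `ex`) with the probe (in `pr`); on a match raise `fnd` and move
the entry's polarity (in `eb`) to `val`; in all cases empty `ex` and `eb`. [folklore] -/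
def lvComma : RProg :=
  ifTop (kr KR.fnd) (fun o => match o with
    | some _ => skip
    | none => (eqW Γ'.blank).map embEq ;; pop (kr KR.ne) fun o' => match o' with
        | some _ => skip
        | none => push (kr KR.fnd) Γ'.blank ;; pop (kr KR.eb) fun o'' => match o'' with
            | some e => push (kr KR.val) e
            | none => skip) ;;
  clear (kr KR.ex) ;; clear (kr KR.eb)

/-- Body of the lookup pass over the copy `vw` of the tuple register: the first symbol of an
entry (mode `lmd` down) is its polarity, saved in `eb`; further bits are index bits, collected
(reversed) in `ex`; the comma closes the entry. [folklore] -/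
def lvBody (s : Γ') : RProg :=
  pop (kr KR.lmd) fun o => match o with
    | none => push (kr KR.eb) s ;; push (kr KR.lmd) Γ'.blank
    | some _ => match s with
      | Γ'.bit d => push (kr KR.ex) (Γ'.bit d) ;; push (kr KR.lmd) Γ'.blank
      | Γ'.comma => lvComma
      | _ => skip

/-- Normalisation of the answer: lower `fnd`, and turn `val` into the flag "the value is `true`".
[folklore] -/
def lvNorm : RProg :=
  clear (kr KR.fnd) ;; pop (kr KR.val) fun o => match o with
    | some (Γ'.bit true) => push (kr KR.val) Γ'.blank
    | _ => skip

/-- `lookupVal`: with the (reversed) index token of `ν` in `pr` and the literal list `L` in the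
tuple register `vt`, set `val` to the flag `lookupB L ν` (= `asg V bs ν` for `L = V.zip bs`),
keeping `pr` and `vt`. [folklore] -/
def lookupVal : RProg :=
  copyToG (tb TB.vt) (kr KR.vw) (kr KR.t1) (kr KR.t2) ;; loop (kr KR.vw) lvBody ;; lvNorm

/-- The polarity of the first literal on `ν` in `L`, as the content of `val` during the pass.
[folklore] -/
def valW (L : List Lit) (ν : ℕ) : List Γ' :=
  match L.find? fun l => l.1 == ν with
  | some l => [Γ'.bit l.2]
  | none => []

/-- The reversed index token (without its comma), as held in a probe register. [folklore] -/
def rbits (ν : ℕ) : List Γ' := ((encodeNat ν).map Γ'.bit).reverse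

/-- `rbits` is injective. [folklore] -/
theorem rbits_injective : Function.Injective rbits := by
  intro a b h
  unfold rbits at h
  have h1 := List.reverse_injective h
  have h2 : encodeNat a = encodeNat b :=
    List.map_injective_iff.2 (fun x y hxy => by simpa using hxy) h1
  rw [← decode_encodeNat a, h2, decode_encodeNat]

/-- The store during the lookup pass: the registers it works on, over an arbitrary base store.
[folklore] -/
def lvSt (S : RStore) (vw fnd val ex eb lmd ne : List Γ') : RStore := fun r =>
  if r = kr KR.vw then vw else if r = kr KR.fnd then fnd else if r = kr KR.val then val else
  if r = kr KR.ex then ex else if r = kr KR.eb then eb else if r = kr KR.lmd then lmd else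
  if r = kr KR.ne then ne else S r

section LvSt

variable (S : RStore) (vw fnd val ex eb lmd ne w : List Γ')

/-- Reading `vw`. [folklore] -/
@[simp] theorem lvSt_vw : lvSt S vw fnd val ex eb lmd ne (kr KR.vw) = vw := by simp [lvSt]
/-- Reading `fnd`. [folklore] -/
@[simp] theorem lvSt_fnd : lvSt S vw fnd val ex eb lmd ne (kr KR.fnd) = fnd := by simp [lvSt]
/-- Reading `val`. [folklore] -/
@[simp] theorem lvSt_val : lvSt S vw fnd val ex eb lmd ne (kr KR.val) = val := by simp [lvSt]
/-- Reading `ex`. [folklore] -/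
@[simp] theorem lvSt_ex : lvSt S vw fnd val ex eb lmd ne (kr KR.ex) = ex := by simp [lvSt]
/-- Reading `eb`. [folklore] -/
@[simp] theorem lvSt_eb : lvSt S vw fnd val ex eb lmd ne (kr KR.eb) = eb := by simp [lvSt]
/-- Reading `lmd`. [folklore] -/
@[simp] theorem lvSt_lmd : lvSt S vw fnd val ex eb lmd ne (kr KR.lmd) = lmd := by simp [lvSt]
/-- Reading `ne`. [folklore] -/
@[simp] theorem lvSt_ne : lvSt S vw fnd val ex eb lmd ne (kr KR.ne) = ne := by simp [lvSt]
/-- Reading any other register. [folklore] -/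
theorem lvSt_other {r : Reg} (h1 : r ≠ kr KR.vw) (h2 : r ≠ kr KR.fnd) (h3 : r ≠ kr KR.val)
    (h4 : r ≠ kr KR.ex) (h5 : r ≠ kr KR.eb) (h6 : r ≠ kr KR.lmd) (h7 : r ≠ kr KR.ne) :
    lvSt S vw fnd val ex eb lmd ne r = S r := by simp [lvSt, h1, h2, h3, h4, h5, h6, h7]
/-- Reading `pr`. [folklore] -/
@[simp] theorem lvSt_pr : lvSt S vw fnd val ex eb lmd ne (kr KR.pr) = S (kr KR.pr) := by simp [lvSt]
/-- Reading `x2`. [folklore] -/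
@[simp] theorem lvSt_x2 : lvSt S vw fnd val ex eb lmd ne (kr KR.x2) = S (kr KR.x2) := by simp [lvSt]
/-- Reading `vt`. [folklore] -/
@[simp] theorem lvSt_vt : lvSt S vw fnd val ex eb lmd ne (tb TB.vt) = S (tb TB.vt) := by simp [lvSt]

/-- Updating `vw`. [folklore] -/
@[simp] theorem update_lvSt_vw :
    Function.update (lvSt S vw fnd val ex eb lmd ne) (kr KR.vw) w = lvSt S w fnd val ex eb lmd ne := by
  funext r; by_cases h : r = kr KR.vw
  · subst h; simp
  · rw [Function.update_of_ne h]; simp [lvSt, h]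
/-- Updating `fnd`. [folklore] -/
@[simp] theorem update_lvSt_fnd :
    Function.update (lvSt S vw fnd val ex eb lmd ne) (kr KR.fnd) w = lvSt S vw w val ex eb lmd ne := by
  funext r; by_cases h : r = kr KR.fnd
  · subst h; simp
  · rw [Function.update_of_ne h]; simp [lvSt, h]
/-- Updating `val`. [folklore] -/
@[simp] theorem update_lvSt_val :
    Function.update (lvSt S vw fnd val ex eb lmd ne) (kr KR.val) w = lvSt S vw fnd w ex eb lmd ne := by
  funext r; by_cases h : r = kr KR.val
  · subst h; simp
  · rw [Function.update_of_ne h]; simp [lvSt, h]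
/-- Updating `ex`. [folklore] -/
@[simp] theorem update_lvSt_ex :
    Function.update (lvSt S vw fnd val ex eb lmd ne) (kr KR.ex) w = lvSt S vw fnd val w eb lmd ne := by
  funext r; by_cases h : r = kr KR.ex
  · subst h; simp
  · rw [Function.update_of_ne h]; simp [lvSt, h]
/-- Updating `eb`. [folklore] -/
@[simp] theorem update_lvSt_eb :
    Function.update (lvSt S vw fnd val ex eb lmd ne) (kr KR.eb) w = lvSt S vw fnd val ex w lmd ne := by
  funext r; by_cases h : r = kr KR.eb
  · subst h; simp
  · rw [Function.update_of_ne h]; simp [lvSt, h]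
/-- Updating `lmd`. [folklore] -/
@[simp] theorem update_lvSt_lmd :
    Function.update (lvSt S vw fnd val ex eb lmd ne) (kr KR.lmd) w = lvSt S vw fnd val ex eb w ne := by
  funext r; by_cases h : r = kr KR.lmd
  · subst h; simp
  · rw [Function.update_of_ne h]; simp [lvSt, h]
/-- Updating `ne`. [folklore] -/
@[simp] theorem update_lvSt_ne :
    Function.update (lvSt S vw fnd val ex eb lmd ne) (kr KR.ne) w = lvSt S vw fnd val ex eb lmd w := by
  funext r; by_cases h : r = kr KR.ne
  · subst h; simp
  · rw [Function.update_of_ne h]; simp [lvSt, h]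
/-- Updating `x2` with its own (empty) content. [folklore] -/
theorem update_lvSt_x2 (h : S (kr KR.x2) = []) :
    Function.update (lvSt S vw fnd val ex eb lmd ne) (kr KR.x2) [] = lvSt S vw fnd val ex eb lmd ne := by
  rw [Function.update_eq_self_iff]; simp [h]
/-- Updating `pr` with its own content. [folklore] -/
theorem update_lvSt_pr :
    Function.update (lvSt S vw fnd val ex eb lmd ne) (kr KR.pr) (S (kr KR.pr)) =
      lvSt S vw fnd val ex eb lmd ne := by
  rw [Function.update_eq_self_iff]; simp

end LvSt

/-- **Specification of `lvComma`** (found flag `p`, current entry `l`, probe `ν`). [folklore] -/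
theorem runs_lvComma (S : RStore) (ν : ℕ) (hpr : S (kr KR.pr) = rbits ν) (hx2 : S (kr KR.x2) = [])
    (l : Lit) (vw val : List Γ') (p : Prop) [Decidable p] :
    Runs lvComma (lvSt S vw (flagW Γ'.blank p) val (rbits l.1) [Γ'.bit l.2] [] [])
      (lvSt S vw (flagW Γ'.blank (p ∨ l.1 = ν))
        (if p then val else if l.1 = ν then Γ'.bit l.2 :: val else val) [] [] [] [])
      (12 * (rbits ν).length + 4 * (rbits l.1).length + 26) := by
  unfold lvComma
  by_cases hp : p
  · -- already found: skip the comparison, clear `ex` and `eb`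
    rw [flagW_true _ hp, if_pos hp, flagW_true _ (Or.inl hp)]
    have h1 : Runs (ifTop (kr KR.fnd) (fun o => match o with
        | some _ => skip
        | none => (eqW Γ'.blank).map embEq ;; pop (kr KR.ne) fun o' => match o' with
            | some _ => skip
            | none => push (kr KR.fnd) Γ'.blank ;; pop (kr KR.eb) fun o'' => match o'' with
                | some e => push (kr KR.val) e
                | none => skip))
        (lvSt S vw [Γ'.blank] val (rbits l.1) [Γ'.bit l.2] [] [])
        (lvSt S vw [Γ'.blank] val (rbits l.1) [Γ'.bit l.2] [] []) (0 + 3) :=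
      Runs.ifTop_cons (x := Γ'.blank) (w := []) (by simp) (Runs.skip _)
    have h2 := runs_clear (kr KR.ex) (lvSt S vw [Γ'.blank] val (rbits l.1) [Γ'.bit l.2] [] [])
    have h3 := runs_clear (kr KR.eb) (lvSt S vw [Γ'.blank] val [] [Γ'.bit l.2] [] [])
    simp only [lvSt_ex, update_lvSt_ex, lvSt_eb, update_lvSt_eb, List.length_singleton] at h2 h3
    exact (h1.seq (h2.seq h3)).mono (by omega)
  · rw [flagW_false _ hp, if_neg hp]
    -- the comparison
    have hE := runs_eqW_map (tk := Γ'.blank) embEq_injective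
      (lvSt S vw [] val (rbits l.1) [Γ'.bit l.2] [] []) (u := rbits ν) (v := rbits l.1)
      (by simp [embEq, hpr]) (by simp [embEq]) (by simp [embEq, hx2]) (by simp [embEq])
    have hE' : Runs ((eqW Γ'.blank).map embEq) (lvSt S vw [] val (rbits l.1) [Γ'.bit l.2] [] [])
        (lvSt S vw [] val [] [Γ'.bit l.2] [] (flagW Γ'.blank (ν ≠ l.1)))
        (12 * (rbits ν).length + 2 * (rbits l.1).length + 12) := by
      have hfl : flagW Γ'.blank (rbits ν ≠ rbits l.1) = flagW Γ'.blank (ν ≠ l.1) :=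
        flagW_congr _ rbits_injective.ne_iff
      rw [hfl] at hE
      refine hE.of_eq ?_ le_rfl
      simp only [embEq]
      rw [← hpr, update_lvSt_pr, update_lvSt_ex, update_lvSt_x2 _ _ _ _ _ _ _ _ hx2, update_lvSt_ne]
    by_cases hν : l.1 = ν
    · -- match: raise `fnd`, move the polarity to `val`
      rw [if_pos hν, flagW_true _ (Or.inr hν)]
      have hne : ¬ (ν ≠ l.1) := fun h => h hν.symm
      rw [flagW_false _ hne] at hE'
      have h3 : Runs (push (kr KR.fnd) Γ'.blank ;; pop (kr KR.eb) fun o'' => match o'' with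
          | some e => push (kr KR.val) e
          | none => skip)
          (lvSt S vw [] val [] [Γ'.bit l.2] [] []) (lvSt S vw [Γ'.blank] (Γ'.bit l.2 :: val) [] [] [] [])
          (1 + (1 + 2)) := by
        refine (Runs.push' (R' := lvSt S vw [Γ'.blank] val [] [Γ'.bit l.2] [] []) (by simp)).seq ?_
        refine Runs.pop_cons (k := kr KR.eb) (a := Γ'.bit l.2) (w := []) (by simp) ?_
        exact Runs.push' (by simp)
      have h23 : Runs (pop (kr KR.ne) fun o' => match o' with
          | some _ => skip
          | none => push (kr KR.fnd) Γ'.blank ;; pop (kr KR.eb) fun o'' => match o'' with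
              | some e => push (kr KR.val) e
              | none => skip)
          (lvSt S vw [] val [] [Γ'.bit l.2] [] []) (lvSt S vw [Γ'.blank] (Γ'.bit l.2 :: val) [] [] [] [])
          (1 + (1 + 2) + 2) := Runs.pop_nil (by simp) h3
      have h1 : Runs (ifTop (kr KR.fnd) (fun o => match o with
          | some _ => skip
          | none => (eqW Γ'.blank).map embEq ;; pop (kr KR.ne) fun o' => match o' with
              | some _ => skip
              | none => push (kr KR.fnd) Γ'.blank ;; pop (kr KR.eb) fun o'' => match o'' with
                  | some e => push (kr KR.val) e
                  | none => skip))
          (lvSt S vw [] val (rbits l.1) [Γ'.bit l.2] [] [])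
          (lvSt S vw [Γ'.blank] (Γ'.bit l.2 :: val) [] [] [] [])
          (12 * (rbits ν).length + 2 * (rbits l.1).length + 12 + (1 + (1 + 2) + 2) + 2) :=
        Runs.ifTop_nil (by simp) (hE'.seq h23)
      have h4 := runs_clear (kr KR.ex) (lvSt S vw [Γ'.blank] (Γ'.bit l.2 :: val) [] [] [] [])
      have h5 := runs_clear (kr KR.eb) (lvSt S vw [Γ'.blank] (Γ'.bit l.2 :: val) [] [] [] [])
      simp only [lvSt_ex, update_lvSt_ex, lvSt_eb, update_lvSt_eb, List.length_nil] at h4 h5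
      exact (h1.seq (h4.seq h5)).mono (by omega)
    · -- no match
      rw [if_neg hν]
      have hor : ¬ (p ∨ l.1 = ν) := fun h => h.elim hp hν
      rw [flagW_false _ hor]
      have hne : ν ≠ l.1 := fun h => hν h.symm
      rw [flagW_true _ hne] at hE'
      have h23 : Runs (pop (kr KR.ne) fun o' => match o' with
          | some _ => skip
          | none => push (kr KR.fnd) Γ'.blank ;; pop (kr KR.eb) fun o'' => match o'' with
              | some e => push (kr KR.val) e
              | none => skip)
          (lvSt S vw [] val [] [Γ'.bit l.2] [] [Γ'.blank]) (lvSt S vw [] val [] [Γ'.bit l.2] [] [])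
          (0 + 2) :=
        Runs.pop_cons (k := kr KR.ne) (a := Γ'.blank) (w := []) (by simp) ((Runs.skip _).of_eq (by simp) le_rfl)
      have h1 : Runs (ifTop (kr KR.fnd) (fun o => match o with
          | some _ => skip
          | none => (eqW Γ'.blank).map embEq ;; pop (kr KR.ne) fun o' => match o' with
              | some _ => skip
              | none => push (kr KR.fnd) Γ'.blank ;; pop (kr KR.eb) fun o'' => match o'' with
                  | some e => push (kr KR.val) e
                  | none => skip))
          (lvSt S vw [] val (rbits l.1) [Γ'.bit l.2] [] [])
          (lvSt S vw [] val [] [Γ'.bit l.2] [] [])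
          (12 * (rbits ν).length + 2 * (rbits l.1).length + 12 + (0 + 2) + 2) :=
        Runs.ifTop_nil (by simp) (hE'.seq h23)
      have h4 := runs_clear (kr KR.ex) (lvSt S vw [] val [] [Γ'.bit l.2] [] [])
      have h5 := runs_clear (kr KR.eb) (lvSt S vw [] val [] [Γ'.bit l.2] [] [])
      simp only [lvSt_ex, update_lvSt_ex, lvSt_eb, update_lvSt_eb, List.length_nil,
        List.length_singleton] at h4 h5
      exact (h1.seq (h4.seq h5)).mono (by omega)

/-- The found flag after scanning the literals `L`. [folklore] -/
def fndW (L : List Lit) (ν : ℕ) : List Γ' := flagW Γ'.blank ((L.find? fun l => l.1 == ν).isSome = true)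

/-- Inside an entry of the tuple register (mode up), index bits are collected in `ex`.
[folklore] -/
theorem segRuns_lvBody_bits (S : RStore) (fnd val eb : List Γ') :
    ∀ (u : List Bool) (rest ex : List Γ'),
      SegRuns (kr KR.vw) lvBody (u.map Γ'.bit)
        (lvSt S (u.map Γ'.bit ++ rest) fnd val ex eb [Γ'.blank] [])
        (lvSt S rest fnd val ((u.map Γ'.bit).reverse ++ ex) eb [Γ'.blank] []) (6 * u.length)
  | [], rest, ex => by simpa using SegRuns.nil (kr KR.vw) lvBody _
  | b :: u, rest, ex => by
    have hbody : Runs (lvBody (Γ'.bit b))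
        (Function.update (lvSt S (Γ'.bit b :: (u.map Γ'.bit ++ rest)) fnd val ex eb [Γ'.blank] [])
          (kr KR.vw) (u.map Γ'.bit ++ rest))
        (lvSt S (u.map Γ'.bit ++ rest) fnd val (Γ'.bit b :: ex) eb [Γ'.blank] []) (2 + 2) := by
      rw [update_lvSt_vw]
      unfold lvBody
      refine Runs.pop_cons (k := kr KR.lmd) (a := Γ'.blank) (w := []) (by simp) ?_
      rw [update_lvSt_lmd]
      exact ((Runs.push' (R' := lvSt S (u.map Γ'.bit ++ rest) fnd val (Γ'.bit b :: ex) eb [] [])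
        (by simp)).seq (Runs.push' (by simp))).of_eq rfl (by norm_num)
    have ih := segRuns_lvBody_bits S fnd val eb u rest (Γ'.bit b :: ex)
    have hk : lvSt S (Γ'.bit b :: (u.map Γ'.bit ++ rest)) fnd val ex eb [Γ'.blank] [] (kr KR.vw) =
        Γ'.bit b :: (u.map Γ'.bit ++ rest) := by simp
    refine (SegRuns.cons hk hbody ih).cast (by simp) (by simp) (by simp) ?_
    simp only [List.length_cons]; omega

/-- **One entry of the lookup pass.** [folklore] -/
theorem segRuns_lvBody_entry (S : RStore) (ν : ℕ) (hpr : S (kr KR.pr) = rbits ν)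
    (hx2 : S (kr KR.x2) = []) (l : Lit) (rest val : List Γ') (p : Prop) [Decidable p] :
    SegRuns (kr KR.vw) lvBody (KCNF.encodeLiteral l)
      (lvSt S (KCNF.encodeLiteral l ++ rest) (flagW Γ'.blank p) val [] [] [] [])
      (lvSt S rest (flagW Γ'.blank (p ∨ l.1 = ν))
        (if p then val else if l.1 = ν then Γ'.bit l.2 :: val else val) [] [] [] [])
      (10 * (KCNF.encodeLiteral l).length + 12 * (rbits ν).length + 16) := by
  obtain ⟨i, b⟩ := l
  have hlit : KCNF.encodeLiteral (i, b) = Γ'.bit b :: ((encodeNat i).map Γ'.bit ++ [Γ'.comma]) := rfl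
  rw [hlit]
  set u := (encodeNat i).map Γ'.bit with hu
  -- the polarity bit
  have h1 : Runs (lvBody (Γ'.bit b))
      (Function.update (lvSt S (Γ'.bit b :: (u ++ [Γ'.comma]) ++ rest) (flagW Γ'.blank p) val [] [] [] [])
        (kr KR.vw) (u ++ [Γ'.comma] ++ rest))
      (lvSt S (u ++ [Γ'.comma] ++ rest) (flagW Γ'.blank p) val [] [Γ'.bit b] [Γ'.blank] []) (2 + 2) := by
    rw [update_lvSt_vw]
    unfold lvBody
    refine Runs.pop_nil (by simp) ?_
    exact ((Runs.push' (R' := lvSt S (u ++ [Γ'.comma] ++ rest) (flagW Γ'.blank p) val [] [Γ'.bit b] [] [])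
      (by simp)).seq (Runs.push' (by simp))).of_eq rfl (by norm_num)
  -- the index bits
  have h2 := segRuns_lvBody_bits S (flagW Γ'.blank p) val [Γ'.bit b] (encodeNat i) ([Γ'.comma] ++ rest) []
  rw [← hu, List.append_nil] at h2
  -- the comma
  have h3 : Runs (lvBody Γ'.comma)
      (Function.update (lvSt S ([Γ'.comma] ++ rest) (flagW Γ'.blank p) val u.reverse [Γ'.bit b] [Γ'.blank] [])
        (kr KR.vw) rest)
      (lvSt S rest (flagW Γ'.blank (p ∨ i = ν))
        (if p then val else if i = ν then Γ'.bit b :: val else val) [] [] [] [])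
      (12 * (rbits ν).length + 4 * (rbits i).length + 26 + 2) := by
    rw [update_lvSt_vw]
    unfold lvBody
    refine Runs.pop_cons (k := kr KR.lmd) (a := Γ'.blank) (w := []) (by simp) ?_
    rw [update_lvSt_lmd]
    have := runs_lvComma S ν hpr hx2 (i, b) rest val p
    exact this
  have hk1 : lvSt S (Γ'.bit b :: (u ++ [Γ'.comma]) ++ rest) (flagW Γ'.blank p) val [] [] [] [] (kr KR.vw) =
      Γ'.bit b :: (u ++ [Γ'.comma] ++ rest) := by simp
  have hk3 : lvSt S ([Γ'.comma] ++ rest) (flagW Γ'.blank p) val u.reverse [Γ'.bit b] [Γ'.blank] [] (kr KR.vw) =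
      Γ'.comma :: rest := by simp
  have h23 := h2.append (SegRuns.single hk3 h3)
  have := SegRuns.cons hk1 h1 (h23.cast rfl (by simp) rfl le_rfl)
  refine this.cast (by simp) rfl rfl ?_
  have hr : (rbits i).length = u.length := by simp [rbits, hu]
  simp only [List.length_cons, List.length_append, List.length_nil, hr]
  have : u.length = (encodeNat i).length := by simp [hu]
  omega

/-- `fndW` unfolds to a flag. [folklore] -/
theorem fndW_eq (L : List Lit) (ν : ℕ) :
    fndW L ν = flagW Γ'.blank ((L.find? fun l => l.1 == ν).isSome = true) := rfl

/-- **The lookup pass over a clause body**, from the state reached after the literals `L₁`.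
[folklore] -/
theorem segRuns_lvBody_cbody (S : RStore) (ν : ℕ) (hpr : S (kr KR.pr) = rbits ν)
    (hx2 : S (kr KR.x2) = []) : ∀ (L₂ L₁ : List Lit) (rest : List Γ'),
    SegRuns (kr KR.vw) lvBody (cbody L₂)
      (lvSt S (cbody L₂ ++ rest) (fndW L₁ ν) (valW L₁ ν) [] [] [] [])
      (lvSt S rest (fndW (L₁ ++ L₂) ν) (valW (L₁ ++ L₂) ν) [] [] [] [])
      ((12 * (rbits ν).length + 16) * L₂.length + 10 * (cbody L₂).length)
  | [], L₁, rest => by simpa using SegRuns.nil (kr KR.vw) lvBody _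
  | l :: L₂, L₁, rest => by
    have h1 := segRuns_lvBody_entry S ν hpr hx2 l (cbody L₂ ++ rest) (valW L₁ ν)
      ((L₁.find? fun l => l.1 == ν).isSome = true)
    -- identify the state after `l` with the state of the prefix `L₁ ++ [l]`
    have hfnd : flagW Γ'.blank (((L₁.find? fun l => l.1 == ν).isSome = true) ∨ l.1 = ν) =
        fndW (L₁ ++ [l]) ν := by
      rw [fndW_eq]
      refine flagW_congr _ ?_
      rw [List.find?_append]
      cases h : L₁.find? (fun l => l.1 == ν) with
      | some l' => simp
      | none =>
        simp only [Option.isSome_none, Bool.false_eq_true, false_or, Option.none_or,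
          List.find?_singleton]
        by_cases hl : l.1 = ν <;> simp [hl]
    have hval : (if ((L₁.find? fun l => l.1 == ν).isSome = true) then valW L₁ ν
        else if l.1 = ν then Γ'.bit l.2 :: valW L₁ ν else valW L₁ ν) = valW (L₁ ++ [l]) ν := by
      unfold valW
      rw [List.find?_append]
      cases h : L₁.find? (fun l => l.1 == ν) with
      | some l' => simp
      | none =>
        simp only [Option.isSome_none, Bool.false_eq_true, ↓reduceIte, Option.none_or,
          List.find?_singleton]
        by_cases hl : l.1 = ν <;> simp [hl]
    rw [← fndW_eq, hfnd, hval] at h1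
    have h2 := segRuns_lvBody_cbody S ν hpr hx2 L₂ (L₁ ++ [l]) rest
    have := h1.append h2
    refine this.cast (by simp [cbody_cons, encodeLiteral_eq]) (by simp [cbody_cons, encodeLiteral_eq])
      (by rw [List.append_assoc]; rfl) ?_
    simp only [cbody_cons, encodeLiteral_eq, List.length_append, List.length_cons, List.length_nil]
    ring_nf; omega

/-- `valW` normalised is the flag of `lookupB`. [folklore] -/
theorem runs_lvNorm (S : RStore) (L : List Lit) (ν : ℕ) (vw ex eb lmd ne : List Γ') :
    Runs lvNorm (lvSt S vw (fndW L ν) (valW L ν) ex eb lmd ne)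
      (lvSt S vw [] (flagW Γ'.blank (lookupB L ν = true)) ex eb lmd ne) 6 := by
  unfold lvNorm
  have h1 := runs_clear (kr KR.fnd) (lvSt S vw (fndW L ν) (valW L ν) ex eb lmd ne)
  rw [lvSt_fnd, update_lvSt_fnd] at h1
  have hlen : (fndW L ν).length ≤ 1 := length_flagW_le _ _
  have h2 : Runs (pop (kr KR.val) fun o => match o with
      | some (Γ'.bit true) => push (kr KR.val) Γ'.blank
      | _ => skip) (lvSt S vw [] (valW L ν) ex eb lmd ne)
      (lvSt S vw [] (flagW Γ'.blank (lookupB L ν = true)) ex eb lmd ne) 3 := by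
    unfold valW lookupB
    cases h : L.find? (fun l => l.1 == ν) with
    | none =>
      simp only [Option.map_none, Option.getD_none, Bool.false_eq_true]
      rw [flagW_false _ not_false]
      exact (Runs.pop_nil (by simp) (Runs.skip _)).mono (by norm_num)
    | some l =>
      obtain ⟨i, b⟩ := l
      simp only [Option.map_some, Option.getD_some]
      refine Runs.pop_cons (k := kr KR.val) (a := Γ'.bit b) (w := []) (by simp) ?_
      rw [update_lvSt_val]
      cases b with
      | true => rw [flagW_true _ rfl]; exact Runs.push' (by simp)
      | false =>
        rw [flagW_false _ (by simp)]
        exact (Runs.skip _).mono (by norm_num)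
  exact (h1.seq h2).mono (by omega)

/-- **Specification of `lookupVal`**: with the reversed index token of `ν` in `pr` and the
literal list `L` in `vt` (all scratch registers empty), `val` becomes the flag `lookupB L ν`,
nothing else changes. [folklore] -/
theorem runs_lookupVal (S : RStore) (ν : ℕ) (L : List Lit) (hpr : S (kr KR.pr) = rbits ν)
    (hvt : S (tb TB.vt) = cbody L) (hvw : S (kr KR.vw) = []) (hfnd : S (kr KR.fnd) = [])
    (hval : S (kr KR.val) = []) (hex : S (kr KR.ex) = []) (heb : S (kr KR.eb) = [])
    (hlmd : S (kr KR.lmd) = []) (hne : S (kr KR.ne) = []) (hx2 : S (kr KR.x2) = [])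
    (ht1 : S (kr KR.t1) = []) (ht2 : S (kr KR.t2) = []) :
    Runs lookupVal S (Function.update S (kr KR.val) (flagW Γ'.blank (lookupB L ν = true)))
      ((12 * (rbits ν).length + 46) * (cbody L).length + 10) := by
  unfold lookupVal
  have hS : S = lvSt S [] (fndW [] ν) (valW [] ν) [] [] [] [] := by
    funext r
    by_cases h1 : r = kr KR.vw; · subst h1; simp [hvw]
    by_cases h2 : r = kr KR.fnd; · subst h2; simp [hfnd, fndW, flagW]
    by_cases h3 : r = kr KR.val; · subst h3; simp [hval, valW]
    by_cases h4 : r = kr KR.ex; · subst h4; simp [hex]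
    by_cases h5 : r = kr KR.eb; · subst h5; simp [heb]
    by_cases h6 : r = kr KR.lmd; · subst h6; simp [hlmd]
    by_cases h7 : r = kr KR.ne; · subst h7; simp [hne]
    rw [lvSt_other _ _ _ _ _ _ _ _ h1 h2 h3 h4 h5 h6 h7]
  have h1 := runs_copyToG (a := tb TB.vt) (b := kr KR.vw) (t₁ := kr KR.t1) (t₂ := kr KR.t2)
    (by simp) (by simp) (by simp) (by simp) (by simp) (by simp) S ht1 ht2 hvw
  rw [hvt] at h1
  have h1' : Runs (copyToG (tb TB.vt) (kr KR.vw) (kr KR.t1) (kr KR.t2)) S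
      (lvSt S (cbody L ++ []) (fndW [] ν) (valW [] ν) [] [] [] []) (10 * (cbody L).length + 3) := by
    refine h1.of_eq ?_ le_rfl
    conv_lhs => rw [hS]
    rw [update_lvSt_vw, List.append_nil]
  have h2 := (segRuns_lvBody_cbody S ν hpr hx2 L [] []).runs_loop_nil (by simp)
  simp only [List.nil_append] at h2
  have h3 := runs_lvNorm S L ν [] [] [] [] []
  refine ((h1'.seq (h2.seq h3))).of_eq ?_ ?_
  · conv_rhs => rw [hS]
    rw [update_lvSt_val]
    have : fndW [] ν = [] := by simp [fndW, flagW]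
    rw [this]
  · have hL : L.length ≤ (cbody L).length := by
      clear h1 h1' h2 h3 hS hvt
      induction L with
      | nil => simp
      | cons a L ih => simp only [cbody_cons, List.length_cons, List.length_append]; omega
    nlinarith [hL]

end Literature.Computability.FineGrained.IPRenameM
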